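import Literature.IUT.HodgeTheaters.PuncturedEllipticProLModelH0
import Literature.IUT.HodgeTheaters.PuncturedEllipticGeomOrigin
import Literature.IUT.HodgeTheaters.PuncturedEllipticCoveringsCor12OfFreePro
import Literature.AnabelianGeometry.AbsoluteAnabelian.FreeProSigmaCompletionBridge
import Literature.AnabelianGeometry.SemiGraphs.ProSigmaCompletionProfiniteExtend
import HarnessLib

/-!
# An infinite pro-`l` model of [IUTchI] §1, part 9: the pro-`l` model as a SHADOW of every `GeomOrigin` datum

Mochizuki, *Inter-universal Teichmüller theory I*, kurims manuscript (May 2020), §1 pp. 37–39 ([IUTchI] §1 p.37)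
[claim: Mochizuki2012, status: disputed]; [AbsTopI] Lemma 4.5 (i) p. 54 (`Δ` of a once-punctured curve free profinite;
the tree's `IsFreeProOn`) [cite: MochizukiAbsTopI2012, Lemma 4.5 (i) p.54].  (D-0012 claim key; series status DISPUTED
— PROOF-ONLY module; nothing of the series is asserted, no side is taken on [IUTchIII] Cor. 3.12.)

Cell abc-iut, seat abc-iut-L5-d4, row R45 «COR12-MODL-LAWS-DERIVE@M_l» (L5-lead RULINGS #118 (2)(a)), bricks B1/B2.
Let `D′ : PuncturedEllipticData` carry abc-iut-L5-t1's origin datum (A) «`Δ_X′ = Π_X′ ∩ Δ_C′` is free profinite on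
`a = gens 0`, `b = gens 1`» (`IsFreeProOn`, the field `GeomOrigin.isFreeProOn`).  Then the pro-`l` group
`P = ℤ_l^{ℤ/l} ⋊ (ℤ_l ⋊ ℤ/2)` of parts 1–8 RECEIVES `Δ_X′`:
* **`exists_shadowHom`** — for ANY targets `p₀ p₁ : P` there is a CONTINUOUS homomorphism `F : Δ_X′ → P` with
  `F a = p₀`, `F b = p₁` (abc-iut-L4's `IsFreeProOn.isProSigmaCompletion_lift` + abc-iut-L3's universal property for
  profinite targets `IsProSigmaCompletion.exists_continuous_extend_profinite`; the open normal subgroups of the compact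
  `P` have finite, hence `Set.univ`-integer, index);
* **`shadowHom_commutator`** — for the STANDARD targets `p₀ = a := (0, a)`, `p₁ = (B_0)`: `F [a, b] = (c_0)`,
  `c_0 = B_1 − B_0` — abc-iut-L5-t1's inertia vector (part 4's `commutator_elA_inN`);
* **`closure_zpowers_inN_cvec`** — `⟨(c_x)⟩⁻ = ℤ_l · c_x = D_x` (the model's inertia LINE);
* **`shadowHom_inertia_le`** — with (c′) «`I′_x = ⟨g [a,b] g⁻¹⟩⁻`» (the field `GeomOrigin.inertia_eq_conj_commutator`):
  `F` maps the cusp inertia group `I′_x` of the GENUINE datum into the model's inertia line `D_{k}`,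
  `k = (F g)·0` (part 2's `conj_smul_Dm`).
So the model's cusp-inertia LINES are the images of the genuine cusp inertia groups — orientation-free — which is
what the descent of the `Δ_ε`-level sentences (parts 7–8) along `F` will use (bricks B0/B3 and the transfers are the
sequel).  HONEST LABEL: a derivation device over OUR interfaces; (A), (c′) are assumption labels (fields of a
hypothesis record), asserted for no datum; no `sorry`; symbolic prime `l`.
-/

noncomputable section

namespace Literature.IUT.HodgeTheaters

namespace PuncturedEllipticData

namespace ProLModel

open DihedralGroup _root_.Topology Literature.AnabelianGeometry.AbsoluteAnabelian
open Literature.AnabelianGeometry.SemiGraphs.SemiGraphOfAnabelioids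
open scoped Pointwise

universe u

variable (l : ℕ) [Fact l.Prime]

/-! ### B1: the shadow homomorphism -/

/-- **The shadow homomorphism.**  If `Δ_X′` is free profinite on `gens : Fin 2 → Δ_X′` then for any `p₀ p₁ ∈ P`
there is a continuous homomorphism `F : Δ_X′ → P` with `F (gens 0) = p₀`, `F (gens 1) = p₁`.
([IUTchI] §1 p.37; [AbsTopI] Lemma 4.5 (i) p.54) [claim: Mochizuki2012, status: disputed] -/
theorem exists_shadowHom (D' : PuncturedEllipticData.{u}) {gens : Fin 2 → ↥(D'.PiX ⊓ D'.DeltaC)}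
    (hfree : IsFreeProOn ↥(D'.PiX ⊓ D'.DeltaC) Set.univ gens) (p₀ p₁ : P l) :
    ∃ F : ↥(D'.PiX ⊓ D'.DeltaC) →* P l, Continuous F ∧ F (gens 0) = p₀ ∧ F (gens 1) = p₁ := by
  classical
  haveI : CompactSpace ↥(D'.PiX ⊓ D'.DeltaC) :=
    isCompact_iff_compactSpace.mp D'.isClosed_piX_inf_deltaC.isCompact
  have hι := hfree.isProSigmaCompletion_lift
  have hB : ∀ V : Subgroup (P l), V.Normal → IsOpen (V : Set (P l)) →
      Literature.AnabelianGeometry.Anabelioids.IsSigmaInteger Set.univ V.index := by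
    intro V _ hV
    haveI : Finite (P l ⧸ V) := Subgroup.quotient_finite_of_isOpen V hV
    haveI : V.FiniteIndex := Subgroup.finiteIndex_of_finite_quotient
    exact ⟨Nat.pos_of_ne_zero Subgroup.FiniteIndex.index_ne_zero, fun p _ _ => Set.mem_univ p⟩
  let f : FreeGroup (Fin 2) →* P l := FreeGroup.lift fun i => if i = 0 then p₀ else p₁
  obtain ⟨F, hFc, hF⟩ := IsProSigmaCompletion.exists_continuous_extend_profinite hι hB f
  refine ⟨F, hFc, ?_, ?_⟩
  · have h := hF (FreeGroup.of 0)
    rw [FreeGroup.lift_apply_of, FreeGroup.lift_apply_of] at h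
    simpa [f] using h
  · have h := hF (FreeGroup.of 1)
    rw [FreeGroup.lift_apply_of, FreeGroup.lift_apply_of] at h
    simpa [f] using h

/-! ### B2: the standard targets `a ↦ a`, `b ↦ B_0` — commutator and inertia images -/

/-- `[a, (B_0)] = (c_0)` in `P`: the model's inertia vector of the cusp `0` IS the commutator of the standard targets.
([IUTchI] §1 p.37) [claim: Mochizuki2012, status: disputed] -/
theorem commutator_elA_one_inN_δ : elA l 1 * inN l (δ l 0) * (elA l 1)⁻¹ * (inN l (δ l 0))⁻¹ = inN l (cvec l 0) := by
  rw [← commutatorElement_def, commutator_elA_inN, map_one]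
  congr 1
  funext m
  simp only [Pi.sub_apply, rot_apply, δ_apply, cvec_apply, zero_add, sub_eq_zero]

/-- **`F [a, b] = (c_0)`** for a shadow homomorphism with the standard targets. ([IUTchI] §1 p.37) [claim: Mochizuki2012, status: disputed] -/
theorem shadowHom_commutator {D' : PuncturedEllipticData.{u}} {gens : Fin 2 → ↥(D'.PiX ⊓ D'.DeltaC)}
    (F : ↥(D'.PiX ⊓ D'.DeltaC) →* P l) (h0 : F (gens 0) = elA l 1) (h1 : F (gens 1) = inN l (δ l 0)) :
    F (gens 0 * gens 1 * (gens 0)⁻¹ * (gens 1)⁻¹) = inN l (cvec l 0) := by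
  rw [map_mul, map_mul, map_mul, map_inv, map_inv, h0, h1, commutator_elA_one_inN_δ]

/-- **`⟨(c_x)⟩⁻ = ℤ_l · c_x = D_x`**: the model's inertia line is the closure of the cyclic group on its vector.
([IUTchI] §1 p.37) [claim: Mochizuki2012, status: disputed] -/
theorem closure_zpowers_inN_cvec (x : ZMod l) :
    (Subgroup.zpowers (inN l (cvec l x))).topologicalClosure = Dm l x := by
  refine le_antisymm ?_ ?_
  · refine Subgroup.topologicalClosure_minimal _ ?_ (isClosed_Dm l x)
    rw [Subgroup.zpowers_le]
    exact ⟨Multiplicative.ofAdd 1, by rw [inertiaHom_apply, toAdd_ofAdd, one_smul]⟩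
  · rintro _ ⟨s, rfl⟩
    rw [inertiaHom_apply]
    exact inN_smul_mem_of_isClosed l _ (Subgroup.isClosed_topologicalClosure _) _
      (Subgroup.le_topologicalClosure _ (Subgroup.mem_zpowers _)) _

/-- Conjugates of the model's inertia line `D_0` are inertia lines: `g D_0 g⁻¹ = D_{g·0}`.
([IUTchI] §1 p.37) [claim: Mochizuki2012, status: disputed] -/
theorem conj_mem_Dm_of_mem {g y : P l} (hy : y ∈ Dm l 0) :
    g * y * g⁻¹ ∈ Dm l (ArrowModel.cuspAct l (toDih l g.right) 0) := by
  rw [← conj_smul_Dm]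
  exact ⟨y, hy, rfl⟩

/-- **The shadow of the genuine cusp inertia.**  If `F : Δ_X′ → P` is a continuous homomorphism with the standard
values on `a, b` and the cusp inertia group `I′_x ⊆ Δ_X′` is `⟨g [a,b] g⁻¹⟩⁻` (the origin datum (c′)), then `F`
maps `I′_x` INTO the model's inertia line `D_k`, `k = (F g)·0`.  ([IUTchI] §1 p.37; [AbsTopIII] Prop. 1.4 (i))
[claim: Mochizuki2012, status: disputed] -/
theorem shadowHom_inertia_le {D' : PuncturedEllipticData.{u}} {gens : Fin 2 → ↥(D'.PiX ⊓ D'.DeltaC)}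
    (F : ↥(D'.PiX ⊓ D'.DeltaC) →* P l) (hF : Continuous F) (h0 : F (gens 0) = elA l 1)
    (h1 : F (gens 1) = inN l (δ l 0)) {I : Subgroup D'.PiC} {g : D'.PiC} (hg : g ∈ D'.PiX ⊓ D'.DeltaC)
    (hI : I = (Subgroup.zpowers (g * ((gens 0 : D'.PiC) * (gens 1 : D'.PiC) * (gens 0 : D'.PiC)⁻¹ *
      (gens 1 : D'.PiC)⁻¹) * g⁻¹)).topologicalClosure)
    (y : ↥(D'.PiX ⊓ D'.DeltaC)) (hy : (y : D'.PiC) ∈ I) :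
    F y ∈ Dm l (ArrowModel.cuspAct l (toDih l (F ⟨g, hg⟩).right) 0) := by
  classical
  set k := ArrowModel.cuspAct l (toDih l (F ⟨g, hg⟩).right) 0 with hk
  -- the commutator and its conjugate, as elements of the subtype `Δ_X′`
  set c : ↥(D'.PiX ⊓ D'.DeltaC) := gens 0 * gens 1 * (gens 0)⁻¹ * (gens 1)⁻¹ with hc
  set z : ↥(D'.PiX ⊓ D'.DeltaC) := ⟨g, hg⟩ * c * ⟨g, hg⟩⁻¹ with hz
  have hzval : (z : D'.PiC) = g * ((gens 0 : D'.PiC) * (gens 1 : D'.PiC) * (gens 0 : D'.PiC)⁻¹ *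
      (gens 1 : D'.PiC)⁻¹) * g⁻¹ := by
    simp only [hz, hc, Subgroup.coe_mul, Subgroup.coe_inv]
  -- `F z ∈ D_k`
  have hFz : F z ∈ Dm l k := by
    rw [hz, map_mul, map_mul, map_inv, hc, shadowHom_commutator l F h0 h1]
    exact conj_mem_Dm_of_mem l ⟨Multiplicative.ofAdd 1, by rw [inertiaHom_apply, toAdd_ofAdd, one_smul]⟩
  -- the closed subgroup `F⁻¹(D_k)` of `Δ_X′` contains `z`, hence `⟨z⟩⁻`
  have hpre : (Subgroup.zpowers z).topologicalClosure ≤ (Dm l k).comap F :=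
    Subgroup.topologicalClosure_minimal _ ((Subgroup.zpowers_le).2 hFz) ((isClosed_Dm l k).preimage hF)
  -- `y ∈ ⟨z⟩⁻` in the subtype, because `↑y ∈ ⟨↑z⟩⁻ = I` in `Π_C′` and the inclusion is an embedding
  have hyz : y ∈ (Subgroup.zpowers z).topologicalClosure := by
    have hemb : IsInducing (Subtype.val : ↥(D'.PiX ⊓ D'.DeltaC) → D'.PiC) := IsInducing.subtypeVal
    change y ∈ closure ((Subgroup.zpowers z : Subgroup _) : Set ↥(D'.PiX ⊓ D'.DeltaC))
    rw [hemb.closure_eq_preimage_closure_image, Set.mem_preimage]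
    have himg : Subtype.val '' ((Subgroup.zpowers z : Subgroup _) : Set ↥(D'.PiX ⊓ D'.DeltaC)) =
        ((Subgroup.zpowers (z : D'.PiC) : Subgroup D'.PiC) : Set D'.PiC) := by
      rw [← Subgroup.coe_subtype, ← Subgroup.coe_map, MonoidHom.map_zpowers]
    rw [himg, hzval, ← Subgroup.topologicalClosure_coe, ← hI]
    exact hy
  exact hpre hyz

/-- **The shadow of the genuine cusp inertia, for a `GeomOrigin` datum** (abc-iut-L5-t1's record): for every cusp `x`
of `X̲′` there is `g ∈ Δ_X′` (the conjugator of (c′)) such that every shadow homomorphism with the standard values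
maps `I′_x` into the model's inertia line `D_{(F g)·0}`. ([IUTchI] §1 p.37) [claim: Mochizuki2012, status: disputed] -/
theorem shadowHom_inertia_le_of_geomOrigin {D' : PuncturedEllipticData.{u}} (O : D'.GeomOrigin)
    (F : ↥(D'.PiX ⊓ D'.DeltaC) →* P l) (hF : Continuous F) (h0 : F (O.gens 0) = elA l 1)
    (h1 : F (O.gens 1) = inN l (δ l 0)) (x : D'.Cusp) :
    ∃ (g : D'.PiC) (hg : g ∈ D'.PiX ⊓ D'.DeltaC), ∀ (y : ↥(D'.PiX ⊓ D'.DeltaC)), (y : D'.PiC) ∈ D'.inertia x →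
      F y ∈ Dm l (ArrowModel.cuspAct l (toDih l (F ⟨g, hg⟩).right) 0) := by
  obtain ⟨g, hg, hI⟩ := O.inertia_eq_conj_commutator x
  exact ⟨g, hg, fun y hy => shadowHom_inertia_le l F hF h0 h1 hg hI y hy⟩

/-- **Existence of the standard shadow** of a `GeomOrigin` datum: a continuous `F : Δ_X′ → P` with `F a = a`,
`F b = (B_0)`, `F [a,b] = (c_0)`. ([IUTchI] §1 p.37) [claim: Mochizuki2012, status: disputed] -/
theorem exists_standardShadow {D' : PuncturedEllipticData.{u}} (O : D'.GeomOrigin) :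
    ∃ F : ↥(D'.PiX ⊓ D'.DeltaC) →* P l, Continuous F ∧ F (O.gens 0) = elA l 1 ∧ F (O.gens 1) = inN l (δ l 0) ∧
      F (O.gens 0 * O.gens 1 * (O.gens 0)⁻¹ * (O.gens 1)⁻¹) = inN l (cvec l 0) := by
  obtain ⟨F, hF, h0, h1⟩ := exists_shadowHom l D' O.isFreeProOn (elA l 1) (inN l (δ l 0))
  exact ⟨F, hF, h0, h1, shadowHom_commutator l F h0 h1⟩

end ProLModel

end PuncturedEllipticData

end Literature.IUT.HodgeTheaters
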